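import Summits.FinalStateConjecture.FinalStateConjecture.Theorems.EIHFluxBalanceInertialRecessionRechartHoleCausal
import Summits.FinalStateConjecture.FinalStateConjecture.Theorems.EIHFluxBalanceInertialRecessionRechartZone
import Literature.Geometry.Lorentzian.CausalityPushUp

/-!
# Route EIHFluxBalance — `InertialRecession`, re-charting: certified static reach, continuity of
# the painted radii, and future-closedness of the exterior region

Helper file for the crux `stmt-FinalStateConjecture-10166`
(`Summit.FinalStateConjecture.FinalStateConjecture.Theses.EIHFluxBalance.InertialRecession`),
stub `stub_rechart` of line `sublinear-is-free-clean-window-charges`. Three inputs of the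
transfer without loitering (`…RechartTransfer2`) for the re-charted `a = 0` hole charts:

* `exists_static_reach_rechart` — CERTIFIED STATIC REACH: for `δ > 0` there is a hole time `S`
  after which every model point with `S ≤ t* ≤ τ₁`, `r₊ + δ ≤ r ≤ R(t*)` lies in `J⁻` of the
  tilted slab `ψ({t* = τ₁, r ≤ R(τ₁)})` (certified static orbits,
  `exists_isFutureDirected_static` + `mem_causalPast_image_truncTimeSlab_of_orbit`);
* `continuous_paintedRadius` — the painted Kerr–Schild radius
  `x ↦ r_a(Λ(x⁰)⁻¹(x − (x⁰, ξ(x⁰))))` is continuous for continuous `ξ`, `Λ`;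
* `mem_exterior_of_causalFuture_of_causalPast` — `O = J⁺(Σ) ∩ I⁻(W)` with `W` open is closed
  under passing to causal-future points that remain in `J⁻(W)` (push-up, O'Neill's Cor. 14.1).

[O'Neill 1983, Ch. 14, pp. 402–404; folklore]
-/

noncomputable section

set_option linter.dupNamespace false

open Set Filter Topology Function TopologicalSpace Literature.Geometry.Lorentzian
open scoped Manifold ContDiff

namespace Summit.FinalStateConjecture.FinalStateConjecture.Theorems

/-! ### Continuity of the painted radius -/

/-- **The painted radius is continuous.** For a continuous centre `ξ` and a frame `Λ` continuous
as an operator-valued map, `x ↦ r_a(Λ(x⁰)⁻¹(x − (x⁰, ξ(x⁰))))` is continuous on `E4` (inversion is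
continuous at the invertible frames, `contDiffAt_map_inverse`; `Kerr.continuous_radius`).
[folklore] -/
theorem continuous_paintedRadius (a : ℝ) (Λ : ℝ → lorentzGroup) (ξ : ℝ → E3)
    (hΛ : Continuous fun t ↦ ((Λ t : E4 ≃L[ℝ] E4) : E4 →L[ℝ] E4)) (hξ : Continuous ξ) :
    Continuous fun z : E4 ↦
      Kerr.radius a (poincareInv (Λ (z 0)) (E4.ofTimeSpace (z 0) (ξ (z 0))) z) := by
  have h0 : Continuous fun z : E4 ↦ z 0 := (EuclideanSpace.proj (0 : Fin 4) : E4 →L[ℝ] ℝ).continuous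
  have hinv : Continuous fun t : ℝ ↦ (((Λ t : E4 ≃L[ℝ] E4).symm : E4 ≃L[ℝ] E4) : E4 →L[ℝ] E4) := by
    have he : (fun t : ℝ ↦ (((Λ t : E4 ≃L[ℝ] E4).symm : E4 ≃L[ℝ] E4) : E4 →L[ℝ] E4)) =
        ContinuousLinearMap.inverse ∘ fun t ↦ ((Λ t : E4 ≃L[ℝ] E4) : E4 →L[ℝ] E4) := by
      funext t
      simp only [comp_apply, ContinuousLinearMap.inverse_equiv]
    rw [he]
    exact continuous_iff_continuousAt.2 fun t ↦
      ContinuousAt.comp (f := fun s : ℝ ↦ ((Λ s : E4 ≃L[ℝ] E4) : E4 →L[ℝ] E4)) (x := t)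
        (contDiffAt_map_inverse (n := 0) (Λ t : E4 ≃L[ℝ] E4)).continuousAt hΛ.continuousAt
  have hc : Continuous fun z : E4 ↦ E4.ofTimeSpace (z 0) (ξ (z 0)) := by
    have : (fun z : E4 ↦ E4.ofTimeSpace (z 0) (ξ (z 0))) =
        fun z ↦ (z 0) • E4.basisVector 0 + E4.ofTimeSpace 0 (ξ (z 0)) :=
      funext fun z ↦ E4.ofTimeSpace_eq_smul_add _ _
    rw [this]
    exact (h0.smul continuous_const).add ((E4.continuous_ofTimeSpace 0).comp (hξ.comp h0))
  have happ : Continuous fun z : E4 ↦ (((Λ (z 0) : E4 ≃L[ℝ] E4).symm : E4 ≃L[ℝ] E4) : E4 →L[ℝ] E4)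
      (z - E4.ofTimeSpace (z 0) (ξ (z 0))) :=
    (hinv.comp h0).clm_apply (continuous_id.sub hc)
  exact (Kerr.continuous_radius a).comp happ

/-! ### Future-closedness of the exterior region below the late image -/

section Exterior

variable {X : Type} [TopologicalSpace X] [ChartedSpace E3 X] [IsManifold (𝓡 3) ∞ X]
  [ConnectedSpace X] {D : InitialDataSet (𝓡 3) X}

/-- **`O = J⁺(Σ) ∩ I⁻(W)` is closed under causal futures inside `J⁻(W)`** (`W` open): if `p ∈ O`,
`z ∈ J⁺(p)` and `z ∈ J⁻(W)`, then `z ∈ O`. The first factor by `J⁺ ∘ J⁺ = J⁺`; the second by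
push-up: `z ≤ w ∈ W`, `w ≪ w'` for some `w' ∈ W` (`W` open), hence `z ≪ w'`. O'Neill 1983, Ch. 14,
Cor. 14.1 and Lemma 14.3. [folklore] -/
theorem mem_exterior_of_causalFuture_of_causalPast (𝒟 : VacuumCauchyDevelopment D)
    {W O : Set 𝒟.carrier} (hW : IsOpen W)
    (hO : O = 𝒟.metric.causalFuture 𝒟.timeOrientation (range 𝒟.embed) ∩
      𝒟.metric.chronologicalPast 𝒟.timeOrientation W)
    {p z : 𝒟.carrier} (hp : p ∈ O) (hz : z ∈ 𝒟.metric.causalFuture 𝒟.timeOrientation {p})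
    (hzW : z ∈ 𝒟.metric.causalPast 𝒟.timeOrientation W) : z ∈ O := by
  have h2 : (2 : ℕ∞ω) ≤ ((⊤ : ℕ∞) : ℕ∞ω) := WithTop.coe_le_coe.mpr le_top
  have h1 : (1 : ℕ∞ω) ≤ ((⊤ : ℕ∞) : ℕ∞ω) := WithTop.coe_le_coe.mpr le_top
  rw [hO] at hp ⊢
  refine ⟨?_, ?_⟩
  · rw [← LorentzianMetric.causalFuture_causalFuture_eq h2 (range 𝒟.embed)]
    exact LorentzianMetric.causalFuture_mono (singleton_subset_iff.mpr hp.1) hz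
  · -- a point `w ∈ W` causally above `z`, then a point `w' ∈ W` chronologically above `w`
    have hwW : ∀ w ∈ W, w ∈ 𝒟.metric.causalFuture 𝒟.timeOrientation {z} →
        z ∈ 𝒟.metric.chronologicalPast 𝒟.timeOrientation W := by
      intro w hw hwz
      have hwI : w ∈ 𝒟.metric.chronologicalPast 𝒟.timeOrientation W :=
        subset_chronologicalPast_of_subset_isOpen hW Subset.rfl hw
      unfold LorentzianMetric.chronologicalPast at hwI ⊢
      rw [LorentzianMetric.chronologicalFuture_eq_biUnion] at hwI ⊢
      simp only [mem_iUnion, exists_prop] at hwI ⊢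
      obtain ⟨w', hw'W, hww'⟩ := hwI
      refine ⟨w', hw'W, ?_⟩
      have hw'w : w' ∈ 𝒟.metric.chronologicalFuture 𝒟.timeOrientation {w} :=
        LorentzianMetric.mem_chronologicalFuture_of_mem_chronologicalPast hww'
      exact LorentzianMetric.mem_chronologicalPast_of_mem_chronologicalFuture
        (LorentzianMetric.mem_chronologicalFuture_of_mem_causalFuture h1 hwz hw'w)
    rcases exists_isFutureCausalCurveOn_of_mem_causalPast hzW with hzw | ⟨γ, a, b, hab, hγ, hγa, hγb⟩
    · exact hwW z hzw (LorentzianMetric.subset_causalFuture _ _ _ (mem_singleton z))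
    · refine hwW (γ b) hγb ?_
      rw [← hγa]
      exact hγ.apply_mem_causalFuture_apply_left ⟨hab.le, le_rfl⟩

end Exterior

/-! ### Small inputs of the assembly -/

/-- A function with everywhere positive derivative which is the identity after `T + 1` takes
values `≥ T + 1` only at arguments `≥ T + 1`. [folklore] -/
theorem le_of_le_apply_of_deriv_pos {θ : ℝ → ℝ} {T s₀ : ℝ} (hθ' : ∀ s, 0 < deriv θ s)
    (hθid : ∀ s, T + 1 ≤ s → θ s = s) (h : T + 1 ≤ θ s₀) : T + 1 ≤ s₀ := by
  by_contra hlt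
  rw [not_le] at hlt
  have := strictMono_of_deriv_pos hθ' hlt
  rw [hθid _ le_rfl] at this
  linarith

/-- **The threshold `T₂`.** With `T₂ τ := (∑ γⱼ)(|τ| + ∑ Rzⱼ) + |τ|`: `(τ + βᵢRzᵢ)/γᵢ⁻¹ ≤ T₂ τ` and
`τ ≤ T₂ τ` (`γᵢ > 0`, `0 ≤ βᵢ ≤ 1`, `Rzᵢ ≥ 0`). [folklore] -/
theorem affine_threshold_family {N : ℕ} (γ β Rz : Fin N → ℝ) (hγ : ∀ i, 0 < γ i)
    (hβ1 : ∀ i, β i ≤ 1) (hRz : ∀ i, 0 ≤ Rz i) (i : Fin N) (τ : ℝ) :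
    (τ + β i * Rz i) / (γ i)⁻¹ ≤ (∑ j, γ j) * (|τ| + ∑ j, Rz j) + |τ| ∧
      τ ≤ (∑ j, γ j) * (|τ| + ∑ j, Rz j) + |τ| := by
  have hγs : γ i ≤ ∑ j, γ j :=
    Finset.single_le_sum (f := fun j ↦ γ j) (fun j _ ↦ (hγ j).le) (Finset.mem_univ i)
  have hsum0 : 0 ≤ ∑ j, Rz j := Finset.sum_nonneg fun j _ ↦ hRz j
  have hγ0 : 0 ≤ ∑ j, γ j := Finset.sum_nonneg fun j _ ↦ (hγ j).le
  have hRzs : Rz i ≤ ∑ j, Rz j :=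
    Finset.single_le_sum (f := fun j ↦ Rz j) (fun j _ ↦ hRz j) (Finset.mem_univ i)
  have h1 : (τ + β i * Rz i) / (γ i)⁻¹ = γ i * (τ + β i * Rz i) := by
    rw [div_eq_mul_inv, inv_inv, mul_comm]
  have h2 : τ + β i * Rz i ≤ |τ| + ∑ j, Rz j := by
    have : β i * Rz i ≤ 1 * Rz i := mul_le_mul_of_nonneg_right (hβ1 i) (hRz i)
    linarith [le_abs_self τ]
  have h3 : γ i * (τ + β i * Rz i) ≤ (∑ j, γ j) * (|τ| + ∑ j, Rz j) :=
    (mul_le_mul_of_nonneg_left h2 (hγ i).le).trans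
      (mul_le_mul_of_nonneg_right hγs (add_nonneg (abs_nonneg _) hsum0))
  have h4 : 0 ≤ (∑ j, γ j) * (|τ| + ∑ j, Rz j) := mul_nonneg hγ0 (add_nonneg (abs_nonneg _) hsum0)
  exact ⟨by rw [h1]; linarith [abs_nonneg τ], by linarith [le_abs_self τ]⟩

/-- **The late painted exterior image is open**: for an open embedding `Φ|{x⁰ > τ₀}` and continuous
painted radii `rpⱼ`, `Φ({x⁰ > τ₀, cⱼ < rpⱼ ∀ j})` is open. [folklore] -/
theorem isOpen_image_late_of_continuous {Y : Type*} [TopologicalSpace Y] {U : Opens E4}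
    {Φ : U → Y} {τ₀ : ℝ} (hembΦ : IsOpenEmbedding (({x : U | τ₀ < x.1 0} : Set U).restrict Φ))
    {N : ℕ} (rp : Fin N → U → ℝ) (hrpc : ∀ j, Continuous (rp j)) (c : Fin N → ℝ) :
    IsOpen (Φ '' {x : U | τ₀ < x.1 0 ∧ ∀ j, c j < rp j x}) := by
  have hPo : IsOpen ({z : ({x : U | τ₀ < x.1 0} : Set U) | ∀ j, c j < rp j z.1} :
      Set ({x : U | τ₀ < x.1 0} : Set U)) := by
    simp only [Set.setOf_forall]
    exact isOpen_iInter_of_finite fun j ↦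
      isOpen_lt continuous_const ((hrpc j).comp continuous_subtype_val)
  have hWeq : (({x : U | τ₀ < x.1 0} : Set U).restrict Φ) ''
      {z : ({x : U | τ₀ < x.1 0} : Set U) | ∀ j, c j < rp j z.1} =
        Φ '' {x : U | τ₀ < x.1 0 ∧ ∀ j, c j < rp j x} := by
    ext q
    constructor
    · rintro ⟨⟨x, hx⟩, hP, rfl⟩
      exact ⟨x, ⟨hx, hP⟩, rfl⟩
    · rintro ⟨x, ⟨hx, hP⟩, rfl⟩
      exact ⟨⟨x, hx⟩, hP, rfl⟩
  rw [← hWeq]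
  exact hembΦ.isOpenMap _ hPo

/-! ### Painted radius versus lab distance at honest late points -/

section Honest

variable {V : E3} (hV : ‖V‖ < 1) (ξ v : ℝ → E3) (hv1 : ∀ t, ‖v t‖ < 1) {κ₀ : ℝ} (hκ₀ : κ₀ < 1)
  (hvs : ∀ t, ‖v t‖ ≤ κ₀) (Λ : ℝ → lorentzGroup)
  (hfut : ∀ t, 0 < (((Λ t : E4 ≃L[ℝ] E4) (E4.basisVector 0)) 0))
  (hvΛ : ∀ t, E4.spatial ((Λ t : E4 ≃L[ℝ] E4) (E4.basisVector 0)) =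
    (((Λ t : E4 ≃L[ℝ] E4) (E4.basisVector 0)) 0) • v t)
  {A : E4 → E4} {T : ℝ} {ρ : ℝ → ℝ}
  (hcovA : ∀ x : E4, T + 1 ≤ x 0 →
    ‖E4.spatial x - ξ (x 0) + (Lorentz.gamma (v (x 0)) ^ 2 / (Lorentz.gamma (v (x 0)) + 1) *
      inner ℝ (v (x 0)) (E4.spatial x - ξ (x 0))) • v (x 0)‖ ≤ ρ (x 0) / 2 →
    ∃ x' : E4, A x' = x ∧ x' 0 = x 0 ∧
      E4.spatial ((Lorentz.boost V hV : E4 ≃L[ℝ] E4).symm x') = E4.spatial x - ξ (x 0) +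
        (Lorentz.gamma (v (x 0)) ^ 2 / (Lorentz.gamma (v (x 0)) + 1) *
          inner ℝ (v (x 0)) (E4.spatial x - ξ (x 0))) • v (x 0) ∧
      ((Lorentz.boost V hV : E4 ≃L[ℝ] E4).symm x') 0 =
        x 0 / Lorentz.gamma V - inner ℝ V (E4.spatial x - ξ (x 0) +
          (Lorentz.gamma (v (x 0)) ^ 2 / (Lorentz.gamma (v (x 0)) + 1) *
            inner ℝ (v (x 0)) (E4.spatial x - ξ (x 0))) • v (x 0)))
  (hrad2 : ∀ (x : E4) (Λ' : lorentzGroup), 0 < ((Λ' : E4 ≃L[ℝ] E4) (E4.basisVector 0)) 0 →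
    E4.spatial ((Λ' : E4 ≃L[ℝ] E4) (E4.basisVector 0)) =
      (((Λ' : E4 ≃L[ℝ] E4) (E4.basisVector 0)) 0) • v (A x 0) →
    min ‖E4.spatial ((Lorentz.boost V hV : E4 ≃L[ℝ] E4).symm x)‖ (ρ (A x 0) / 2) ≤
        E4.spatialNorm ((Λ' : E4 ≃L[ℝ] E4).symm (A x - E4.ofTimeSpace (A x 0) (ξ (A x 0)))) ∧
      E4.spatialNorm ((Λ' : E4 ≃L[ℝ] E4).symm (A x - E4.ofTimeSpace (A x 0) (ξ (A x 0)))) ≤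
        ‖E4.spatial ((Lorentz.boost V hV : E4 ≃L[ℝ] E4).symm x)‖)

include hv1 hκ₀ hvs hfut hvΛ hcovA hrad2 in
/-- **Painted radius `≤ γ₀ ×` lab distance at honest late lab points**: if `T + 1 ≤ x⁰` and
`γ₀‖x̲ − ξ(x⁰)‖ ≤ ρ(x⁰)/2` (`γ₀ = (1 − κ₀²)^{-1/2}`), then the painted radius of `x` is at most
`γ₀‖x̲ − ξ(x⁰)‖` (coverage by the hole chart and the two-sided painted radius). [folklore] -/
theorem paintedRadius_le_gamma_mul_dist (x : E4) (hx0 : T + 1 ≤ x 0)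
    (hxρ : (Real.sqrt (1 - κ₀ ^ 2))⁻¹ * ‖E4.spatial x - ξ (x 0)‖ ≤ ρ (x 0) / 2) :
    Kerr.radius 0 (poincareInv (Λ (x 0)) (E4.ofTimeSpace (x 0) (ξ (x 0))) x) ≤
      (Real.sqrt (1 - κ₀ ^ 2))⁻¹ * ‖E4.spatial x - ξ (x 0)‖ := by
  set γ₀ : ℝ := (Real.sqrt (1 - κ₀ ^ 2))⁻¹ with hγ₀
  set t := x 0 with ht
  set w : E3 := E4.spatial x - ξ t with hw
  set P : E3 := w + (Lorentz.gamma (v t) ^ 2 / (Lorentz.gamma (v t) + 1) * inner ℝ (v t) w) • v t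
    with hP
  have hPle : ‖P‖ ≤ γ₀ * ‖w‖ := (norm_restOffsetInv_le (hv1 t) w).trans
    (mul_le_mul_of_nonneg_right (lorentzGamma_le_of_norm_le hκ₀ (hvs t)) (norm_nonneg _))
  obtain ⟨x', hAx', hx'0, hsp, -⟩ := hcovA x hx0 (hPle.trans hxρ)
  have hx't : A x' 0 = t := by rw [hAx']
  obtain ⟨-, hup⟩ := hrad2 x' (Λ t) (hfut t) (by rw [hx't]; exact hvΛ t)
  rw [hsp, hAx'] at hup
  rw [← ht] at hup
  rw [← hw] at hup
  rw [← hP] at hup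
  have hrp' : Kerr.radius 0 (poincareInv (Λ t) (E4.ofTimeSpace t (ξ t)) x) =
      E4.spatialNorm (((Λ t : E4 ≃L[ℝ] E4)).symm (x - E4.ofTimeSpace t (ξ t))) := by
    rw [radius_poincareInv_eq, Kerr.radius_zero_left, ContinuousLinearEquiv.coe_coe]
  rw [hrp']
  exact hup.trans hPle

end Honest

/-! ### Certified static reach of the re-charted hole chart -/

section Static

variable {𝓢 : Spacetime 4} (U : Opens E4) (Φ : U → 𝓢.carrier)
  (hΦ : ContMDiff 𝓘(ℝ, E4) (𝓡 4) ∞ Φ) {M : ℝ} (hM : 0 < M) {V : E3} (hV : ‖V‖ < 1)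
  {A : E4 → E4} {θ : ℝ → ℝ} (hA : ContDiff ℝ ∞ A)
  (hAU : ∀ x ∈ (boostedKerrBackground (Lorentz.boost V hV) 0 M 0).domain, A x ∈ U)
  (hθ' : ∀ s, 0 < deriv θ s) (hDA : ∀ x w : E4, (fderiv ℝ A x w) 0 = deriv θ (x 0) * w 0)
  (Q : U → Prop)
  (hOfut : ∀ x : U, Q x → ∀ w : E4, 0 < w 0 →
    𝓢.metric.val (Φ x) (mfderiv 𝓘(ℝ, E4) (𝓡 4) Φ x w) (mfderiv 𝓘(ℝ, E4) (𝓡 4) Φ x w) < 0 →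
      𝓢.timeOrientation.IsFutureDirected (mfderiv 𝓘(ℝ, E4) (𝓡 4) Φ x w))
  (hQA : ∀ y : (boostedKerrBackground (Lorentz.boost V hV) 0 M 0).domain, Q ⟨A y.1, hAU y.1 y.2⟩)
  (R : ℝ → ℝ) (hRm : Monotone R)
  (hconv : Tendsto (fun τ ↦ 𝓢.truncDeviationCk (boostedKerrBackground (Lorentz.boost V hV) 0 M 0)
    (fun y ↦ Φ ⟨A y.1, hAU y.1 y.2⟩) 2 (R τ) τ) atTop (𝓝 0))

include hΦ hM hA hθ' hDA hOfut hQA hRm hconv in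
/-- **Certified static reach.** For every `δ > 0` there is a hole time `S` such that every model
point `y` with `S ≤ t*(y) ≤ τ₁` and `r₊ + δ ≤ r(y) ≤ R(t*(y))` lies in the causal past of the tilted
slab `ψ({t* = τ₁, r ≤ R(τ₁)})`: follow the static orbit `σ ↦ ψ(y + σΛ∞e₀)`, certified by
`exists_isFutureDirected_static`. [folklore] -/
theorem exists_static_reach_rechart {δ : ℝ} (hδ : 0 < δ) :
    ∃ S : ℝ, ∀ (y : (boostedKerrBackground (Lorentz.boost V hV) 0 M 0).domain) (τ₁ : ℝ),
      S ≤ (boostedKerrBackground (Lorentz.boost V hV) 0 M 0).time y.1 →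
      (boostedKerrBackground (Lorentz.boost V hV) 0 M 0).time y.1 ≤ τ₁ →
      Kerr.rPlus M 0 + δ ≤ (boostedKerrBackground (Lorentz.boost V hV) 0 M 0).radius y.1 →
      (boostedKerrBackground (Lorentz.boost V hV) 0 M 0).radius y.1 ≤
        R ((boostedKerrBackground (Lorentz.boost V hV) 0 M 0).time y.1) →
      Φ ⟨A y.1, hAU y.1 y.2⟩ ∈ 𝓢.metric.causalPast 𝓢.timeOrientation
        ((fun y : (boostedKerrBackground (Lorentz.boost V hV) 0 M 0).domain ↦
          Φ ⟨A y.1, hAU y.1 y.2⟩) ''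
          (boostedKerrBackground (Lorentz.boost V hV) 0 M 0).truncTimeSlab (R τ₁) τ₁) := by
  obtain ⟨S₀, hS₀⟩ := exists_isFutureDirected_static U Φ hΦ hM hV hA hAU hθ' hDA Q hOfut hQA R
    hconv hδ
  refine ⟨S₀, fun y τ₁ hyS hy₁ hyr hyR ↦ ?_⟩
  exact mem_causalPast_image_truncTimeSlab_of_orbit
    (boostedKerrBackground (Lorentz.boost V hV) 0 M 0)
    ((Lorentz.boost V hV : E4 ≃L[ℝ] E4) (E4.basisVector 0))
    (fun x hx σ ↦ kb_boosted_static_mem hV M x hx σ) (kb_boosted_static_time hV M)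
    (kb_boosted_static_radius hV M) _ (contMDiff_comp_smooth hA hAU (fun _ ↦ rfl) hΦ) R hRm
    hS₀ y hyS hyr hyR hy₁

/-- One-line threshold form used by the assembly (registered helper stub
`le_half_of_two_mul_le_rechart` of the crux item): `2|S|γ ≤ t`, `γ > 0` give `S ≤ γ⁻¹ t / 2`.
[folklore] -/
theorem le_half_of_two_mul_le_rechart : ∀ {S γ t : ℝ}, 0 < γ → 2 * |S| * γ ≤ t → S ≤ γ⁻¹ * t / 2 :=
  fun {S γ t} hγ h ↦ by
    have h6 : |S| ≤ γ⁻¹ * t / 2 := by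
      rw [show γ⁻¹ * t / 2 = t / (2 * γ) by field_simp, le_div_iff₀ (by positivity)]
      linarith
    exact (le_abs_self S).trans h6

end Static

end Summit.FinalStateConjecture.FinalStateConjecture.Theorems
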